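import Mathlib
import Summits.ValiantsHypothesis.ValiantsHypothesis.Theorems.KPlusLogSqLawStepSlopes

/-!
# The STEP CRITERION (necessity) for the static path model behind `KPlusLogSqLaw.TropicalB`

Cell pub-symmetroid, seat conjb-2 (g21). A helper toward the crux `TropicalB`
(`Summit.ValiantsHypothesis.ValiantsHypothesis.Theses.KPlusLogSqLaw.TropicalB`, item
`stmt-ValiantsHypothesis-19771`); it earns no crux credit and is not evidence for `MatrixDescartes` or for
Valiant's hypothesis.

Lines `S t θ = b t + s t * θ`, windows separated when the even-indexed lines lie strictly above the odd-indexed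
ones (THEORY-NOTE-g21 §1–§3). THE STEP LEMMA (single inner line): if `d` is odd, the window `[i, i+d]` is
separated somewhere, `[i+1, i+d+1]` is separated somewhere and no `θ` separates both (a *step* of the reach
profile at row `i`), then some inner line of `[i+1, i+d]` of the parity opposite to the two outer lines `i`,
`i+d+1` has its slope STRICTLY BETWEEN the slopes of the two outer lines:

* `step_between_even` (`i` even: an odd inner line `o` with `s i < s o < s (i+d+1)` or
  `s (i+d+1) < s o < s i`),
* `step_between_odd` (`i` odd: an even inner line `e` with the same property).

Located fact of the cell (THEORY-NOTE-g21 §3.1bis): over the alphabet `{±1, ±2}` this necessary condition is also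
sufficient for the realisability of a step by some intercepts, exactly, at reaches 3, 5, 7 (all 128 + 2048 + 32768
slope words); sufficiency in general is an easy construction and is not recorded here.

Proof (the sup argument of THEORY-NOTE-g21 §3.1, kernel form `step_between_core`, stated for an arbitrary class
`up` of upper lines so that both parities of `i` follow by symmetry): order the two separation sets by
`KPlusLogSqLawStepSlopes.step_slopes_even/odd`, say `[i, i+d]` separates to the left; let `r` be the supremum of
its separation set `T`. Every comparison of `[i, i+d]` is `≥ 0` at `r` (`affine_nonneg_at_csSup`); an inner
comparison (not through the line `i`) is even `> 0` at `r`, because it is also a comparison of `[i+1, i+d+1]`,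
positive at a point `≥ r`, and vanishing at `r` would force it negative there; if no comparison through `i`
vanished at `r`, all comparisons of `[i, i+d]` would be positive on a neighbourhood of `r`
(`affine_family_pos_nhds`), contradicting `r = sup T`. So some lower inner line `o` meets the line `i` at `r`,
with `s i < s o` (the comparison is positive to the left of `r`). If `s (i+d+1) ≤ s o`, the comparison of
`i+d+1` with `o` is non-increasing, positive at a separation point of `[i+1, i+d+1]` (which is `≥ r`), hence
positive at `r`; then every comparison of `[i+1, i+d+1]` is positive at `r`, hence on a neighbourhood of `r`,
which contains points of `T` — a common separation point, contradiction.
-/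

set_option linter.dupNamespace false

namespace Summit.ValiantsHypothesis.ValiantsHypothesis.Theorems.KPlusLogSqLawStepBetween

open Finset
open Summit.ValiantsHypothesis.ValiantsHypothesis.Theorems.KPlusLogSqLawReachThreeNoSecondStep (affine_pos_of_le)
open Summit.ValiantsHypothesis.ValiantsHypothesis.Theorems.KPlusLogSqLawStepPair (affine_pos_of_ge)
open Summit.ValiantsHypothesis.ValiantsHypothesis.Theorems.KPlusLogSqLawStepSlopes (step_slopes_even step_slopes_odd)

/-- An affine function positive on a nonempty bounded-above set of reals is non-negative at its supremum. -/
theorem affine_nonneg_at_csSup (T : Set ℝ) (hne : T.Nonempty) (hbdd : BddAbove T) (fa fb : ℝ)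
    (hpos : ∀ θ ∈ T, 0 < fa + fb * θ) : 0 ≤ fa + fb * sSup T := by
  by_contra h
  have h' : fa + fb * sSup T < 0 := not_le.mp h
  obtain ⟨θ0, hθ0⟩ := hne
  have hθ0le : θ0 ≤ sSup T := le_csSup hbdd hθ0
  by_cases hfb : 0 ≤ fb
  · have := affine_pos_of_le θ0 (sSup T) fa fb (hpos θ0 hθ0) hfb hθ0le
    linarith
  · have hfb' : fb < 0 := not_le.mp hfb
    have hδ : 0 < (fa + fb * sSup T) / fb := div_pos_of_neg_of_neg h' hfb'
    obtain ⟨θ, hθT, hθ⟩ := exists_lt_of_lt_csSup ⟨θ0, hθ0⟩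
      (show sSup T - (fa + fb * sSup T) / fb < sSup T by linarith)
    have hθle : θ ≤ sSup T := le_csSup hbdd hθT
    have hval := hpos θ hθT
    have hfb0 : fb ≠ 0 := ne_of_lt hfb'
    have hid : fb * ((fa + fb * sSup T) / fb) = fa + fb * sSup T := by
      field_simp
    -- fb * (θ - sSup T) < fb * ( - (fa + fb * sSup T) / fb ) = -(fa + fb * sSup T)
    have h1 : sSup T - θ < (fa + fb * sSup T) / fb := by linarith
    have h2 : fb * ((fa + fb * sSup T) / fb) < fb * (sSup T - θ) := mul_lt_mul_of_neg_left h1 hfb'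
    have h3 : fa + fb * θ = (fa + fb * sSup T) - fb * (sSup T - θ) := by ring
    linarith

/-- A finite family of affine functions, all positive at `r`, is positive on a neighbourhood of `r`. -/
theorem affine_family_pos_nhds (S : Finset (ℕ × ℕ)) (fa fb : ℕ × ℕ → ℝ) (r : ℝ)
    (h : ∀ c ∈ S, 0 < fa c + fb c * r) :
    ∃ ε : ℝ, 0 < ε ∧ ∀ c ∈ S, ∀ θ : ℝ, r - ε ≤ θ → θ ≤ r + ε → 0 < fa c + fb c * θ := by
  classical
  rcases S.eq_empty_or_nonempty with hS | hS
  · subst hS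
    exact ⟨1, one_pos, by simp⟩
  · -- width allowed by one member
    let g : ℕ × ℕ → ℝ := fun c => if fb c = 0 then 1 else (fa c + fb c * r) / (2 * |fb c|)
    have gpos : ∀ c ∈ S, 0 < g c := by
      intro c hc
      by_cases h0 : fb c = 0
      · simp [g, h0]
      · have : 0 < |fb c| := abs_pos.mpr h0
        simp only [g, h0, if_false]
        exact div_pos (h c hc) (by linarith)
    refine ⟨S.inf' hS g, (Finset.lt_inf'_iff hS).mpr gpos, ?_⟩
    intro c hc θ hlo hhi
    have hεc : S.inf' hS g ≤ g c := Finset.inf'_le g hc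
    have hv := h c hc
    by_cases h0 : fb c = 0
    · rw [h0] at hv ⊢
      simpa using hv
    · have habs : 0 < |fb c| := abs_pos.mpr h0
      have hg : g c = (fa c + fb c * r) / (2 * |fb c|) := by simp [g, h0]
      have hprod : |fb c| * g c * 2 = fa c + fb c * r := by
        rw [hg]
        field_simp
      -- |fb c * (θ - r)| ≤ |fb c| * ε ≤ |fb c| * g c = (fa c + fb c * r) / 2
      have hdist : |θ - r| ≤ S.inf' hS g := abs_le.mpr ⟨by linarith, by linarith⟩
      have hm : |fb c * (θ - r)| ≤ |fb c| * g c := by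
        rw [abs_mul]
        exact mul_le_mul_of_nonneg_left (le_trans hdist hεc) (abs_nonneg _)
      have hlow : -(|fb c| * g c) ≤ fb c * (θ - r) := by
        have := neg_abs_le (fb c * (θ - r))
        linarith
      have hid : fa c + fb c * θ = (fa c + fb c * r) + fb c * (θ - r) := by ring
      nlinarith [hprod, hlow, hid, hv]

/-- THE STEP LEMMA, kernel core, for an arbitrary class `up` of upper lines containing the two outer lines `i` and
`i+d+1`: if `[i, i+d]` and `[i+1, i+d+1]` are each separated somewhere (upper lines strictly above the other lines of
the window), never simultaneously, with `[i, i+d]` separating to the left of `[i+1, i+d+1]`, and `[i+1, i+d]` contains a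
non-upper line, then some non-upper line `o` of `[i+1, i+d]` has `s i < s o < s (i+d+1)`. -/
theorem step_between_core (up : ℕ → Prop) (s b : ℕ → ℝ) (i d : ℕ) (hup0 : up i) (hup1 : up (i + d + 1))
    (hlow : ∃ o : ℕ, i + 1 ≤ o ∧ o ≤ i + d ∧ ¬ up o)
    (hA : ∃ θ : ℝ, ∀ e o : ℕ, i ≤ e → e ≤ i + d → i ≤ o → o ≤ i + d → up e → ¬ up o →
      b o + s o * θ < b e + s e * θ)
    (hB : ∃ θ : ℝ, ∀ e o : ℕ, i + 1 ≤ e → e ≤ i + d + 1 → i + 1 ≤ o → o ≤ i + d + 1 → up e → ¬ up o →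
      b o + s o * θ < b e + s e * θ)
    (hAB : ∀ θ : ℝ, ¬ ((∀ e o : ℕ, i ≤ e → e ≤ i + d → i ≤ o → o ≤ i + d → up e → ¬ up o →
      b o + s o * θ < b e + s e * θ) ∧ (∀ e o : ℕ, i + 1 ≤ e → e ≤ i + d + 1 → i + 1 ≤ o → o ≤ i + d + 1 →
      up e → ¬ up o → b o + s o * θ < b e + s e * θ)))
    (hord : ∀ θ θ' : ℝ, (∀ e o : ℕ, i ≤ e → e ≤ i + d → i ≤ o → o ≤ i + d → up e → ¬ up o →
      b o + s o * θ < b e + s e * θ) → (∀ e o : ℕ, i + 1 ≤ e → e ≤ i + d + 1 → i + 1 ≤ o → o ≤ i + d + 1 →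
      up e → ¬ up o → b o + s o * θ' < b e + s e * θ') → θ < θ') :
    ∃ o : ℕ, i + 1 ≤ o ∧ o ≤ i + d ∧ ¬ up o ∧ s i < s o ∧ s o < s (i + d + 1) := by
  classical
  obtain ⟨θA, hθA⟩ := hA
  obtain ⟨θB, hθB⟩ := hB
  set T : Set ℝ := {θ : ℝ | ∀ e o : ℕ, i ≤ e → e ≤ i + d → i ≤ o → o ≤ i + d → up e → ¬ up o →
      b o + s o * θ < b e + s e * θ} with hT
  have memT : ∀ θ : ℝ, θ ∈ T ↔ ∀ e o : ℕ, i ≤ e → e ≤ i + d → i ≤ o → o ≤ i + d → up e → ¬ up o →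
      b o + s o * θ < b e + s e * θ := fun θ => Iff.rfl
  have hAT : θA ∈ T := (memT θA).2 hθA
  have hne : T.Nonempty := ⟨θA, hAT⟩
  have hub : ∀ θ ∈ T, θ ≤ θB := fun θ hθ => le_of_lt (hord θ θB ((memT θ).1 hθ) hθB)
  have hbdd : BddAbove T := ⟨θB, hub⟩
  have hAle : θA ≤ sSup T := le_csSup hbdd hAT
  have hBge : sSup T ≤ θB := csSup_le hne hub
  -- Claim A: every comparison of `[i, i+d]` is `≥ 0` at `sSup T`
  have clA : ∀ e o : ℕ, i ≤ e → e ≤ i + d → i ≤ o → o ≤ i + d → up e → ¬ up o →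
      b o + s o * sSup T ≤ b e + s e * sSup T := by
    intro e o h1 h2 h3 h4 he ho
    have := affine_nonneg_at_csSup T hne hbdd (b e - b o) (s e - s o) (fun θ hθ => by
      have := (memT θ).1 hθ e o h1 h2 h3 h4 he ho
      linarith)
    linarith
  -- an affine function vanishing at `sSup T`, positive at `θA ≤ sSup T` and at `θB ≥ sSup T` is impossible
  have novanish : ∀ fa fb : ℝ, 0 < fa + fb * θA → 0 < fa + fb * θB → fa + fb * sSup T = 0 → False := by
    intro fa fb hxa hxb h0
    by_cases hm : 0 ≤ fb
    · have p : 0 ≤ fb * (sSup T - θA) := mul_nonneg hm (by linarith)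
      have i1 : fa + fb * θA = (fa + fb * sSup T) - fb * (sSup T - θA) := by ring
      linarith
    · have hm' : fb < 0 := not_le.mp hm
      have p : 0 ≤ (-fb) * (θB - sSup T) := mul_nonneg (by linarith) (by linarith)
      have i1 : fa + fb * θB = (fa + fb * sSup T) - (-fb) * (θB - sSup T) := by ring
      linarith
  -- Claim B1: inner comparisons (upper line `≠ i`) are `> 0` at `sSup T`
  have clB1 : ∀ e o : ℕ, i + 1 ≤ e → e ≤ i + d → i ≤ o → o ≤ i + d → up e → ¬ up o →
      b o + s o * sSup T < b e + s e * sSup T := by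
    intro e o h1 h2 h3 h4 he ho
    have hoi : o ≠ i := fun h => ho (h ▸ hup0)
    rcases lt_or_eq_of_le (clA e o (by omega) h2 h3 h4 he ho) with hlt | heq
    · exact hlt
    · exfalso
      have dA := hθA e o (by omega) h2 h3 h4 he ho
      have dB := hθB e o h1 (by omega) (by omega) (by omega) he ho
      exact novanish (b e - b o) (s e - s o) (by linarith) (by linarith) (by linarith)
  -- Claim B2: some comparison through the line `i` vanishes at `sSup T`
  have clB2 : ∃ o : ℕ, i + 1 ≤ o ∧ o ≤ i + d ∧ ¬ up o ∧ b o + s o * sSup T = b i + s i * sSup T := by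
    by_contra hnot
    -- then every comparison of `[i, i+d]` is `> 0` at `sSup T`
    have hall : ∀ e o : ℕ, i ≤ e → e ≤ i + d → i ≤ o → o ≤ i + d → up e → ¬ up o →
        b o + s o * sSup T < b e + s e * sSup T := by
      intro e o h1 h2 h3 h4 he ho
      have hoi : o ≠ i := fun h => ho (h ▸ hup0)
      by_cases hei : e = i
      · subst hei
        rcases lt_or_eq_of_le (clA e o h1 h2 h3 h4 he ho) with hlt | heq
        · exact hlt
        · exact absurd ⟨o, by omega, h4, ho, heq⟩ hnot
      · exact clB1 e o (by omega) h2 h3 h4 he ho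
    -- positivity on a neighbourhood of `sSup T`
    set PA : Finset (ℕ × ℕ) := ((Icc i (i + d)) ×ˢ (Icc i (i + d))).filter (fun p => up p.1 ∧ ¬ up p.2)
      with hPA
    have memA : ∀ p : ℕ × ℕ, p ∈ PA ↔
        ((i ≤ p.1 ∧ p.1 ≤ i + d) ∧ (i ≤ p.2 ∧ p.2 ≤ i + d)) ∧ (up p.1 ∧ ¬ up p.2) := by
      intro p
      simp only [hPA, Finset.mem_filter, Finset.mem_product, Finset.mem_Icc]
    obtain ⟨ε, hε, hfam⟩ := affine_family_pos_nhds PA (fun p => b p.1 - b p.2) (fun p => s p.1 - s p.2)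
      (sSup T) (by
        intro c hc
        obtain ⟨⟨⟨h1, h2⟩, ⟨h3, h4⟩⟩, ⟨he, ho⟩⟩ := (memA c).1 hc
        have := hall c.1 c.2 h1 h2 h3 h4 he ho
        linarith)
    have hmem : sSup T + ε ∈ T := by
      rw [memT]
      intro e o h1 h2 h3 h4 he ho
      have := hfam (e, o) ((memA (e, o)).2 ⟨⟨⟨h1, h2⟩, ⟨h3, h4⟩⟩, ⟨he, ho⟩⟩) (sSup T + ε)
        (by linarith) (le_refl _)
      simp only at this
      linarith
    have := le_csSup hbdd hmem
    linarith
  obtain ⟨o, ho1, ho2, hou, hoeq⟩ := clB2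
  have hoi : o ≠ i := fun h => hou (h ▸ hup0)
  -- Claim B3: `s i < s o`
  have clB3 : s i < s o := by
    by_contra hge
    have hge' : 0 ≤ s i - s o := by linarith [not_lt.mp hge]
    have dA := hθA i o (le_refl _) (by omega) (by omega) ho2 hup0 hou
    have p : 0 ≤ (s i - s o) * (sSup T - θA) := mul_nonneg hge' (by linarith)
    have i1 : (b i - b o) + (s i - s o) * θA
        = ((b i - b o) + (s i - s o) * sSup T) - (s i - s o) * (sSup T - θA) := by ring
    linarith
  refine ⟨o, ho1, ho2, hou, clB3, ?_⟩
  -- Claim B4: `s o < s (i+d+1)`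
  by_contra hge
  have hle : s (i + d + 1) - s o ≤ 0 := by linarith [not_lt.mp hge]
  have dB := hθB (i + d + 1) o (by omega) (le_refl _) ho1 (by omega) hup1 hou
  have eR : 0 < (b (i + d + 1) - b o) + (s (i + d + 1) - s o) * sSup T :=
    affine_pos_of_ge θB (sSup T) (b (i + d + 1) - b o) (s (i + d + 1) - s o) (by linarith) hle hBge
  -- every comparison of `[i+1, i+d+1]` is `> 0` at `sSup T`
  have hallB : ∀ e o' : ℕ, i + 1 ≤ e → e ≤ i + d + 1 → i + 1 ≤ o' → o' ≤ i + d + 1 → up e → ¬ up o' →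
      b o' + s o' * sSup T < b e + s e * sSup T := by
    intro e o' h1 h2 h3 h4 he ho'
    have ho'top : o' ≠ i + d + 1 := fun h => ho' (h ▸ hup1)
    by_cases hetop : e = i + d + 1
    · subst hetop
      have := clA i o' (le_refl _) (by omega) (by omega) (by omega) hup0 ho'
      linarith
    · exact clB1 e o' h1 (by omega) (by omega) (by omega) he ho'
  set PB : Finset (ℕ × ℕ) :=
    ((Icc (i + 1) (i + d + 1)) ×ˢ (Icc (i + 1) (i + d + 1))).filter (fun p => up p.1 ∧ ¬ up p.2) with hPB
  have memB : ∀ p : ℕ × ℕ, p ∈ PB ↔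
      ((i + 1 ≤ p.1 ∧ p.1 ≤ i + d + 1) ∧ (i + 1 ≤ p.2 ∧ p.2 ≤ i + d + 1)) ∧ (up p.1 ∧ ¬ up p.2) := by
    intro p
    simp only [hPB, Finset.mem_filter, Finset.mem_product, Finset.mem_Icc]
  obtain ⟨ε, hε, hfam⟩ := affine_family_pos_nhds PB (fun p => b p.1 - b p.2) (fun p => s p.1 - s p.2)
    (sSup T) (by
      intro c hc
      obtain ⟨⟨⟨h1, h2⟩, ⟨h3, h4⟩⟩, ⟨he, ho'⟩⟩ := (memB c).1 hc
      have := hallB c.1 c.2 h1 h2 h3 h4 he ho'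
      linarith)
  -- a point of `T` within `ε` of `sSup T` separates both windows
  obtain ⟨θ, hθT, hθ⟩ := exists_lt_of_lt_csSup hne (show sSup T - ε < sSup T by linarith)
  have hθle : θ ≤ sSup T := le_csSup hbdd hθT
  apply hAB θ
  refine ⟨(memT θ).1 hθT, ?_⟩
  intro e o' h1 h2 h3 h4 he ho'
  have := hfam (e, o') ((memB (e, o')).2 ⟨⟨⟨h1, h2⟩, ⟨h3, h4⟩⟩, ⟨he, ho'⟩⟩) θ (by linarith) (by linarith)
  simp only at this
  linarith

/-- THE STEP LEMMA (single inner line), even first line: a step from `[i, i+d]` to `[i+1, i+d+1]` (`i` even,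
`d` odd) forces an odd line `o` of `[i+1, i+d]` whose slope lies strictly between `s i` and `s (i+d+1)`. -/
theorem step_between_even (s b : ℕ → ℝ) (i d : ℕ) (hi : Even i) (hd : Odd d)
    (hA : ∃ θ : ℝ, ∀ e o : ℕ, i ≤ e → e ≤ i + d → i ≤ o → o ≤ i + d → Even e → Odd o →
      b o + s o * θ < b e + s e * θ)
    (hB : ∃ θ : ℝ, ∀ e o : ℕ, i + 1 ≤ e → e ≤ i + d + 1 → i + 1 ≤ o → o ≤ i + d + 1 → Even e → Odd o →
      b o + s o * θ < b e + s e * θ)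
    (hAB : ∀ θ : ℝ, ¬ ((∀ e o : ℕ, i ≤ e → e ≤ i + d → i ≤ o → o ≤ i + d → Even e → Odd o →
      b o + s o * θ < b e + s e * θ) ∧ (∀ e o : ℕ, i + 1 ≤ e → e ≤ i + d + 1 → i + 1 ≤ o → o ≤ i + d + 1 →
      Even e → Odd o → b o + s o * θ < b e + s e * θ))) :
    ∃ o : ℕ, Odd o ∧ i + 1 ≤ o ∧ o ≤ i + d ∧
      ((s i < s o ∧ s o < s (i + d + 1)) ∨ (s (i + d + 1) < s o ∧ s o < s i)) := by
  have hi2 := Nat.even_iff.mp hi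
  have hd2 := Nat.odd_iff.mp hd
  have hup1 : Even (i + d + 1) := Nat.even_iff.mpr (by omega)
  have hlow : ∃ o : ℕ, i + 1 ≤ o ∧ o ≤ i + d ∧ ¬ Even o :=
    ⟨i + 1, le_refl _, by omega, fun h => by have := Nat.even_iff.mp h; omega⟩
  obtain ⟨θA, hθA⟩ := hA
  obtain ⟨θB, hθB⟩ := hB
  obtain ⟨o1, o1', -, -, -, -, -, -, hcase⟩ :=
    step_slopes_even s b i d hi hd ⟨θA, hθA⟩ ⟨θB, hθB⟩ hAB
  rcases hcase with ⟨-, -, hord⟩ | ⟨-, -, hord⟩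
  · -- `[i, i+d]` separates to the left: apply the core directly
    obtain ⟨o, ho1, ho2, hou, h5, h6⟩ := step_between_core (fun n => Even n) s b i d hi hup1 hlow
      ⟨θA, fun e o h1 h2 h3 h4 he ho => hθA e o h1 h2 h3 h4 he (Nat.not_even_iff_odd.mp ho)⟩
      ⟨θB, fun e o h1 h2 h3 h4 he ho => hθB e o h1 h2 h3 h4 he (Nat.not_even_iff_odd.mp ho)⟩
      (fun θ hθ => hAB θ
        ⟨fun e o h1 h2 h3 h4 he ho => hθ.1 e o h1 h2 h3 h4 he (Nat.not_even_iff_odd.mpr ho),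
         fun e o h1 h2 h3 h4 he ho => hθ.2 e o h1 h2 h3 h4 he (Nat.not_even_iff_odd.mpr ho)⟩)
      (fun θ θ' hθ hθ' => hord θ θ'
        (fun e o h1 h2 h3 h4 he ho => hθ e o h1 h2 h3 h4 he (Nat.not_even_iff_odd.mpr ho))
        (fun e o h1 h2 h3 h4 he ho => hθ' e o h1 h2 h3 h4 he (Nat.not_even_iff_odd.mpr ho)))
    exact ⟨o, Nat.not_even_iff_odd.mp hou, ho1, ho2, Or.inl ⟨h5, h6⟩⟩
  · -- `[i+1, i+d+1]` separates to the left: apply the core to the reflected family `θ ↦ -θ`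
    obtain ⟨o, ho1, ho2, hou, h5, h6⟩ := step_between_core (fun n => Even n) (fun t => - s t) b i d hi hup1
      hlow
      ⟨-θA, fun e o h1 h2 h3 h4 he ho => by
        have := hθA e o h1 h2 h3 h4 he (Nat.not_even_iff_odd.mp ho)
        simp only [neg_mul_neg]
        exact this⟩
      ⟨-θB, fun e o h1 h2 h3 h4 he ho => by
        have := hθB e o h1 h2 h3 h4 he (Nat.not_even_iff_odd.mp ho)
        simp only [neg_mul_neg]
        exact this⟩
      (fun θ hθ => hAB (-θ)
        ⟨fun e o h1 h2 h3 h4 he ho => by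
          have := hθ.1 e o h1 h2 h3 h4 he (Nat.not_even_iff_odd.mpr ho)
          simp only [neg_mul, mul_neg] at this ⊢
          exact this,
         fun e o h1 h2 h3 h4 he ho => by
          have := hθ.2 e o h1 h2 h3 h4 he (Nat.not_even_iff_odd.mpr ho)
          simp only [neg_mul, mul_neg] at this ⊢
          exact this⟩)
      (fun θ θ' hθ hθ' => by
        have := hord (-θ) (-θ')
          (fun e o h1 h2 h3 h4 he ho => by
            have := hθ e o h1 h2 h3 h4 he (Nat.not_even_iff_odd.mpr ho)
            simp only [neg_mul, mul_neg] at this ⊢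
            exact this)
          (fun e o h1 h2 h3 h4 he ho => by
            have := hθ' e o h1 h2 h3 h4 he (Nat.not_even_iff_odd.mpr ho)
            simp only [neg_mul, mul_neg] at this ⊢
            exact this)
        linarith)
    exact ⟨o, Nat.not_even_iff_odd.mp hou, ho1, ho2, Or.inr ⟨by linarith, by linarith⟩⟩

/-- THE STEP LEMMA (single inner line), odd first line: a step from `[i, i+d]` to `[i+1, i+d+1]` (`i` odd,
`d` odd) forces an even line `e` of `[i+1, i+d]` whose slope lies strictly between `s i` and `s (i+d+1)`. -/
theorem step_between_odd (s b : ℕ → ℝ) (i d : ℕ) (hi : Odd i) (hd : Odd d)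
    (hA : ∃ θ : ℝ, ∀ e o : ℕ, i ≤ e → e ≤ i + d → i ≤ o → o ≤ i + d → Even e → Odd o →
      b o + s o * θ < b e + s e * θ)
    (hB : ∃ θ : ℝ, ∀ e o : ℕ, i + 1 ≤ e → e ≤ i + d + 1 → i + 1 ≤ o → o ≤ i + d + 1 → Even e → Odd o →
      b o + s o * θ < b e + s e * θ)
    (hAB : ∀ θ : ℝ, ¬ ((∀ e o : ℕ, i ≤ e → e ≤ i + d → i ≤ o → o ≤ i + d → Even e → Odd o →
      b o + s o * θ < b e + s e * θ) ∧ (∀ e o : ℕ, i + 1 ≤ e → e ≤ i + d + 1 → i + 1 ≤ o → o ≤ i + d + 1 →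
      Even e → Odd o → b o + s o * θ < b e + s e * θ))) :
    ∃ e : ℕ, Even e ∧ i + 1 ≤ e ∧ e ≤ i + d ∧
      ((s (i + d + 1) < s e ∧ s e < s i) ∨ (s i < s e ∧ s e < s (i + d + 1))) := by
  have hi2 := Nat.odd_iff.mp hi
  have hd2 := Nat.odd_iff.mp hd
  have hup1 : Odd (i + d + 1) := Nat.odd_iff.mpr (by omega)
  have hlow : ∃ o : ℕ, i + 1 ≤ o ∧ o ≤ i + d ∧ ¬ Odd o :=
    ⟨i + 1, le_refl _, by omega, fun h => by have := Nat.odd_iff.mp h; omega⟩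
  obtain ⟨θA, hθA⟩ := hA
  obtain ⟨θB, hθB⟩ := hB
  obtain ⟨e1, e1', -, -, -, -, -, -, hcase⟩ :=
    step_slopes_odd s b i d hi hd ⟨θA, hθA⟩ ⟨θB, hθB⟩ hAB
  rcases hcase with ⟨-, -, hord⟩ | ⟨-, -, hord⟩
  · -- `[i, i+d]` separates to the left: core with upper class `Odd` on the negated lines `-S t`
    obtain ⟨o, ho1, ho2, hou, h5, h6⟩ := step_between_core (fun n => Odd n) (fun t => - s t) (fun t => - b t)
      i d hi hup1 hlow
      ⟨θA, fun e o h1 h2 h3 h4 he ho => by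
        have := hθA o e h3 h4 h1 h2 (Nat.not_odd_iff_even.mp ho) he
        linarith⟩
      ⟨θB, fun e o h1 h2 h3 h4 he ho => by
        have := hθB o e h3 h4 h1 h2 (Nat.not_odd_iff_even.mp ho) he
        linarith⟩
      (fun θ hθ => hAB θ
        ⟨fun e o h1 h2 h3 h4 he ho => by
          have := hθ.1 o e h3 h4 h1 h2 ho (Nat.not_odd_iff_even.mpr he)
          linarith,
         fun e o h1 h2 h3 h4 he ho => by
          have := hθ.2 o e h3 h4 h1 h2 ho (Nat.not_odd_iff_even.mpr he)
          linarith⟩)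
      (fun θ θ' hθ hθ' => hord θ θ'
        (fun e o h1 h2 h3 h4 he ho => by
          have := hθ o e h3 h4 h1 h2 ho (Nat.not_odd_iff_even.mpr he)
          linarith)
        (fun e o h1 h2 h3 h4 he ho => by
          have := hθ' o e h3 h4 h1 h2 ho (Nat.not_odd_iff_even.mpr he)
          linarith))
    exact ⟨o, Nat.not_odd_iff_even.mp hou, ho1, ho2, Or.inl ⟨by linarith, by linarith⟩⟩
  · -- `[i+1, i+d+1]` separates to the left: negated lines and `θ ↦ -θ`
    obtain ⟨o, ho1, ho2, hou, h5, h6⟩ := step_between_core (fun n => Odd n) s (fun t => - b t)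
      i d hi hup1 hlow
      ⟨-θA, fun e o h1 h2 h3 h4 he ho => by
        have := hθA o e h3 h4 h1 h2 (Nat.not_odd_iff_even.mp ho) he
        linarith⟩
      ⟨-θB, fun e o h1 h2 h3 h4 he ho => by
        have := hθB o e h3 h4 h1 h2 (Nat.not_odd_iff_even.mp ho) he
        linarith⟩
      (fun θ hθ => hAB (-θ)
        ⟨fun e o h1 h2 h3 h4 he ho => by
          have := hθ.1 o e h3 h4 h1 h2 ho (Nat.not_odd_iff_even.mpr he)
          linarith,
         fun e o h1 h2 h3 h4 he ho => by
          have := hθ.2 o e h3 h4 h1 h2 ho (Nat.not_odd_iff_even.mpr he)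
          linarith⟩)
      (fun θ θ' hθ hθ' => by
        have := hord (-θ) (-θ')
          (fun e o h1 h2 h3 h4 he ho => by
            have := hθ o e h3 h4 h1 h2 ho (Nat.not_odd_iff_even.mpr he)
            linarith)
          (fun e o h1 h2 h3 h4 he ho => by
            have := hθ' o e h3 h4 h1 h2 ho (Nat.not_odd_iff_even.mpr he)
            linarith)
        linarith)
    exact ⟨o, Nat.not_odd_iff_even.mp hou, ho1, ho2, Or.inr ⟨h5, h6⟩⟩

end Summit.ValiantsHypothesis.ValiantsHypothesis.Theorems.KPlusLogSqLawStepBetween
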